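import Summits.KontsevichZagierPeriods.KontsevichZagierPeriods.Theses.VietaFibre
import Summits.KontsevichZagierPeriods.KontsevichZagierPeriods.Theses.FurushoPentagon
import Summits.KontsevichZagierPeriods.KontsevichZagierPeriods.Theorems.VietaFibreKernelFormStubCubeMul
import HarnessLib

/-!
# Crux `KernelForm` (stmt-KontsevichZagierPeriods-10447), line `Sketch`: the second cut
# `KernelForm ↔ NIL ∧ ReducedPeriodRing`, and idempotents under Cancellation

Two stubs of the line lead's skeleton, both over the Kontsevich–Zagier calculus of `KZCalculus.lean`
(no new definitions). Write `P = KZ.FormalRep ⧸ KZ.relations` for the formal period ring (a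
commutative ring: `KZ.relations` is a two-sided ideal, `*` is commutative modulo relations, and the
unit cube `[[0,1]^m, 1]` is a unit modulo relations, `stub_cubeMul`) and `𝔭 = ker eval`.

* `kernelForm_iff_nil_and_reducedPeriodRing` — **the second cut of the crux**: `KernelForm`
  (`𝔭 = 0`) holds iff NIL (`c ∈ 𝔭 ⇒ c² ≡ 0`: every value-zero class squares to zero) AND route
  FurushoPentagon's crux `ReducedPeriodRing` (`c² ≡ 0 ⇒ c ≡ 0`, stmt-3929). `→`: `relations` is an
  ideal, and `eval (c * c) = (eval c)²` with soundness; `←`: compose.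
* `idempotent_of_cancellation` — **Cancellation kills non-trivial idempotents**: if multipliers of
  non-zero value are non-zero-divisors on `P`, then every idempotent `e` of `P` is `0` or `1 = [U]`.
  Soundness gives `eval e ∈ {0, 1}`; if `eval e = 0` the canceller `e - [U]` (value `-1`) kills `e`
  (`(e - [U]) * e ≡ e² - e ≡ 0`), so `e ≡ 0`; if `eval e = 1` the same argument applies to the
  complementary idempotent `[U] - e`.

References: M. Kontsevich, D. Zagier, *Periods* (2001), §1.2 (rules (1)–(3) and Conjecture 1),
§4.1 (products).
-/

noncomputable section

open MeasureTheory Set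
open Literature.NumberTheory.Transcendental

namespace Summit.KontsevichZagierPeriods.KernelForm.LocaliseAtValuePrime

/-- **The second cut `KernelForm ↔ NIL ∧ ReducedPeriodRing`.** `→`: NIL because `relations` is an
ideal (`c ∈ relations ⇒ c * c ∈ relations`); reducedness because `c * c ∈ relations` forces
`(eval c)² = 0` (soundness and `KZ.eval_mul'`), hence `eval c = 0`. `←`: a value-zero `c` has
`c * c ∈ relations` by NIL, hence `c ∈ relations` by reducedness. [folklore] -/
theorem kernelForm_iff_nil_and_reducedPeriodRing :
    Summit.KontsevichZagierPeriods.KontsevichZagierPeriods.Theses.VietaFibre.KernelForm ↔ (∀ c : KZ.FormalRep, KZ.eval c = 0 → c * c ∈ KZ.relations) ∧ Summit.KontsevichZagierPeriods.KontsevichZagierPeriods.Theses.FurushoPentagon.ReducedPeriodRing := by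
  unfold Summit.KontsevichZagierPeriods.KontsevichZagierPeriods.Theses.VietaFibre.KernelForm
    Summit.KontsevichZagierPeriods.KontsevichZagierPeriods.Theses.FurushoPentagon.ReducedPeriodRing
  constructor
  · intro hK
    refine ⟨fun c hc => KZ.mul_mem_relations_left_holds _ _ (hK c hc), fun c hcc => hK c ?_⟩
    have h0 := KZ.relations_le_ker_eval_holds hcc
    rw [AddMonoidHom.mem_ker, KZ.eval_mul'] at h0
    exact mul_self_eq_zero.mp h0
  · rintro ⟨hN, hR⟩ c hc
    exact hR c (hN c hc)

/-- **Cancellation ⇒ `P = FormalRep ⧸ relations` has no non-trivial idempotents**: if every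
multiplier of non-zero value is a non-zero-divisor modulo relations, then an idempotent `e`
(`e * e - e ∈ relations`) is `≡ 0` or `≡ [U]`, `U = [[0,1]^m, 1]` the unit cube (the unit of `P`).
Soundness gives `eval e * (eval e - 1) = 0`. If `eval e = 0`, the canceller `s = e - [U]` has value
`-1 ≠ 0` and `s * e = (e * e - e) - ([U] * e - e) ∈ relations`, so `e ∈ relations`; if `eval e = 1`,
the complementary idempotent `[U] - e` has value `0` and the first case applies to it. [folklore] -/
theorem idempotent_of_cancellation :
    (∀ c s : KZ.FormalRep, KZ.eval s ≠ 0 → s * c ∈ KZ.relations → c ∈ KZ.relations) → ∀ (m : ℕ) (U : KZ.IntegralRep m), U.domain = KZ.cube m → (U.integrand = fun _ => 1) → ∀ e : KZ.FormalRep, e * e - e ∈ KZ.relations → e ∈ KZ.relations ∨ KZ.of U - e ∈ KZ.relations := by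
  intro hC m U hUd hUi
  -- the unit cube has value `1`
  have hUv : U.value = 1 := by
    rw [KZ.IntegralRep.value_eq_volume_real U (fun x _ => by rw [hUi]), hUd, KZ.volume_real_cube]
  -- and is a LEFT unit modulo relations (right unit `stub_cubeMul` + commutativity mod relations)
  have hUl : ∀ c : KZ.FormalRep, KZ.of U * c - c ∈ KZ.relations := fun c => by
    have hsplit : KZ.of U * c - c = (KZ.of U * c - c * KZ.of U) + (c * KZ.of U - c) := by abel
    rw [hsplit]
    exact KZ.relations.add_mem (KZ.mul_sub_mul_comm_mem_relations _ _)
      (stub_cubeMul m U c hUd hUi)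
  -- an idempotent of value `0` is a relation: cancel `e - [U]`
  have key : ∀ e : KZ.FormalRep, e * e - e ∈ KZ.relations → KZ.eval e = 0 → e ∈ KZ.relations := by
    intro e he he0
    refine hC e (e - KZ.of U) ?_ ?_
    · rw [map_sub, KZ.eval_of, hUv, he0]
      norm_num
    · have hsplit : (e - KZ.of U) * e = (e * e - e) - (KZ.of U * e - e) := by
        rw [sub_mul]; abel
      rw [hsplit]
      exact KZ.relations.sub_mem he (hUl e)
  intro e he
  -- soundness: `eval e * (eval e - 1) = 0`
  have h0 := KZ.relations_le_ker_eval_holds he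
  rw [AddMonoidHom.mem_ker, map_sub, KZ.eval_mul', ← mul_sub_one] at h0
  rcases mul_eq_zero.mp h0 with h | h
  · exact Or.inl (key e he h)
  · refine Or.inr (key (KZ.of U - e) ?_ ?_)
    · have hsplit : (KZ.of U - e) * (KZ.of U - e) - (KZ.of U - e) =
          (KZ.of U * KZ.of U - KZ.of U) - (KZ.of U * e - e) - (e * KZ.of U - e) + (e * e - e) := by
        simp only [sub_mul, mul_sub]; abel
      rw [hsplit]
      exact KZ.relations.add_mem (KZ.relations.sub_mem (KZ.relations.sub_mem
        (stub_cubeMul m U (KZ.of U) hUd hUi) (hUl e)) (stub_cubeMul m U e hUd hUi)) he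
    · rw [map_sub, KZ.eval_of, hUv, sub_eq_zero.mp h, sub_self]

end Summit.KontsevichZagierPeriods.KernelForm.LocaliseAtValuePrime
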